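import Mathlib.LinearAlgebra.PiTensorProduct.Basic
import Mathlib.Algebra.Algebra.Subalgebra.Basic
import Mathlib.RingTheory.Ideal.Maps
import Mathlib.Algebra.Module.Submodule.Pointwise
import Mathlib.RingTheory.Finiteness.Basic
import HarnessLib

/-!
# Integral forms of tensor products: `⨂_i N_i ⊆ ⨂_i V_i` for lattices `N_i ⊆ V_i` over a subring

Topic `LinearAlgebra/BaseChange`; namespace `Literature.LinearAlgebra.BaseChange`.  One definition
with a body and theorems; no named fact, no instance, no `sorry`.

Let `𝒪 ⊆ k` be a subring of a commutative ring, `(V_i)_{i ∈ ι}` a finite family of `k`-modules and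
`N_i ⊆ V_i` `𝒪`-submodules ("integral structures", e.g. `𝒪`-lattices in `k`-vector spaces).  The
**integral form of the tensor product** is the `𝒪`-submodule
`piTensorIntForm 𝒪 N = ⟨v_1 ⊗ ⋯ ⊗ v_r : v_i ∈ N_i⟩_𝒪 ⊆ ⨂_i V_i` — the image of `⨂_{i,𝒪} N_i`.
This file proves the four elementary facts by which an integral structure on each factor of a
tensor product of representations gives an integral structure on the tensor product (the standard
construction of the `𝒪`-lattices `M_ξ ⊆ ξ` in algebraic representations `ξ = ⊗_τ ξ_τ` of
`Res_{F/ℚ} GL_n`, [Scholze2015, §V.4, before Thm. V.4.1]: "with coefficients in a finite free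
`ℤ̄_p`-module `M_ξ`, such that `M_ξ[p⁻¹] = M_{ξ,K} ⊗ ℚ̄_p`"; [KhareThorne2017, §6.4], the
`𝒪[GL_n(𝒪_{F,p})]`-modules `M_𝛌 = ⊗_τ M_{λ_τ}`):

* `map_mem_piTensorIntForm` — **stability**: if `k`-linear maps `f_i : V_i → V_i` preserve the
  `N_i`, then `⨂_i f_i` preserves `piTensorIntForm 𝒪 N`;
* `map_sub_mem_smul_piTensorIntForm` — **congruences**: if moreover `f_i ≡ 1 (mod I)` on `N_i`
  (`f_i v - v ∈ I • N_i`) for an ideal `I ⊆ 𝒪`, then `(⨂_i f_i) x - x ∈ I • piTensorIntForm 𝒪 N`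
  for every integral `x` (multilinear expansion `⊗(v_i + y_i) = ∑_S ⊗(…)`, Mathlib
  `MultilinearMap.map_add_univ`) — the mechanism by which a level `K_p` that is small enough acts
  trivially on `M_ξ / pᵐ` (loc. cit.);
* `span_piTensorIntForm_eq_top` — **it is a `k`-form**: if each `N_i` spans `V_i` over `k`, the
  integral form spans `⨂_i V_i` over `k`;
* `piTensorIntForm_fg` — **finiteness**: if each `N_i` is finitely generated, so is the integral form
  (generated by the tensors of generators).

All four rest on one induction over the coordinates (`tprod_mem_of_mem_span`: a submodule
containing the pure tensors of vectors from sets `S_i` contains the pure tensors of vectors from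
their spans), valid for any coefficient ring `R → k` acting compatibly (`R = k` or `R = 𝒪`).

## References

* P. Scholze, *On torsion in the cohomology of locally symmetric varieties*, Ann. of Math. 182
  (2015), §V.4 (arXiv:1306.2070, p. 66). [Scholze2015]
* C. Khare, J. A. Thorne, *Potential automorphy and the Leopoldt conjecture*, Amer. J. Math. 139
  (2017), §6.4. [KhareThorne2017]
* N. Bourbaki, *Algebra I*, Ch. II §7 no. 7 (extension of scalars of tensor products; lattices).
  [folklore]
-/

noncomputable section

open scoped TensorProduct
open PiTensorProduct

namespace Literature.LinearAlgebra.BaseChange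

universe u v w

variable {k : Type u} [CommRing k] (𝒪 : Subring k) {ι : Type v}
  {V : ι → Type w} [∀ i, AddCommGroup (V i)] [∀ i, Module k (V i)]

/-! ### One induction over the coordinates -/

/-- **Pure tensors of vectors from spans.**  Let `R → k` act compatibly on the `V_i` (`R = k`, or
`R = 𝒪` a subring; `R` acts on `⨂_i V_i` through `k`), `W ⊆ ⨂_i V_i` an `R`-submodule and
`S_i ⊆ V_i` sets.
If `W` contains `⊗_i v_i` whenever every `v_i ∈ S_i`, then `W` contains `⊗_i v_i` whenever every
`v_i` lies in the `R`-span of `S_i` (induction on the set of coordinates already relaxed, using that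
`z ↦ ⊗(…, z, …)` is linear). [folklore] -/
theorem tprod_mem_of_mem_span [Fintype ι] {R : Type*} [CommSemiring R] [Algebra R k]
    [∀ i, Module R (V i)] [∀ i, IsScalarTower R k (V i)]
    (W : Submodule R (⨂[k] i, V i)) (S : ∀ i, Set (V i))
    (hW : ∀ m : ∀ i, V i, (∀ i, m i ∈ S i) → tprod k m ∈ W)
    (m : ∀ i, V i) (hm : ∀ i, m i ∈ Submodule.span R (S i)) : tprod k m ∈ W := by
  classical
  suffices h : ∀ (s : Finset ι) (m : ∀ i, V i), (∀ i ∉ s, m i ∈ S i) →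
      (∀ i ∈ s, m i ∈ Submodule.span R (S i)) → tprod k m ∈ W from
    h Finset.univ m (fun i hi => absurd (Finset.mem_univ i) hi) fun i _ => hm i
  intro s
  induction s using Finset.induction_on with
  | empty =>
    intro m hS _
    exact hW m fun i => hS i (Finset.notMem_empty i)
  | insert i₀ s hi₀ ih =>
    intro m hS hN
    -- the `R`-linear map `z ↦ ⊗(m with z at i₀)`
    let L : V i₀ →ₗ[R] ⨂[k] i, V i :=
      { toFun := fun z => tprod k (Function.update m i₀ z)
        map_add' := fun z z' => MultilinearMap.map_update_add _ _ _ _ _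
        map_smul' := fun r z => by
          rw [RingHom.id_apply, ← algebraMap_smul k r z, MultilinearMap.map_update_smul,
            algebraMap_smul] }
    have hL : ∀ z, L z = tprod k (Function.update m i₀ z) := fun z => rfl
    have hsub : Submodule.span R (S i₀) ≤ W.comap L := by
      rw [Submodule.span_le]
      intro z hz
      rw [SetLike.mem_coe, Submodule.mem_comap, hL]
      refine ih _ (fun i hi => ?_) fun i hi => ?_
      · by_cases h : i = i₀
        · subst h
          rw [Function.update_self]
          exact hz
        · rw [Function.update_of_ne h]
          exact hS i (by simp [h, hi])
      · have h : i ≠ i₀ := fun h => hi₀ (h ▸ hi)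
        rw [Function.update_of_ne h]
        exact hN i (Finset.mem_insert_of_mem hi)
    have h := hsub (hN i₀ (Finset.mem_insert_self i₀ s))
    rw [Submodule.mem_comap, hL, Function.update_eq_self] at h
    exact h

/-! ### The integral form of a tensor product -/

variable (N : ∀ i, Submodule 𝒪 (V i))

/-- The pure tensors of integral vectors, `{⊗_i v_i | v_i ∈ N_i}`. [folklore] -/
def intTprods : Set (⨂[k] i, V i) :=
  {x | ∃ m : ∀ i, V i, (∀ i, m i ∈ N i) ∧ tprod k m = x}

/-- **The integral form `⟨⊗_i v_i : v_i ∈ N_i⟩_𝒪 ⊆ ⨂_i V_i`** of the tensor product attached to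
integral structures `N_i ⊆ V_i` over the subring `𝒪 ⊆ k` (the image of `⨂_{i,𝒪} N_i`); for
`𝒪`-lattices `M_{λ_τ} ⊆ V_{λ_τ}` this is the lattice `M_𝛌 = ⊗_τ M_{λ_τ} ⊆ ⊗_τ V_{λ_τ}`.
[cite: KhareThorne2017, §6.4 (M_𝛌)] [cite: Scholze2015, §V.4 (M_ξ ⊆ M_{ξ,K} ⊗ ℚ̄_p)] -/
def piTensorIntForm : Submodule 𝒪 (⨂[k] i, V i) :=
  Submodule.span 𝒪 (intTprods 𝒪 N)

variable {𝒪 N}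

/-- Pure tensors of integral vectors are integral. [folklore] -/
theorem tprod_mem_piTensorIntForm {m : ∀ i, V i} (hm : ∀ i, m i ∈ N i) :
    tprod k m ∈ piTensorIntForm 𝒪 N :=
  Submodule.subset_span ⟨m, hm, rfl⟩

/-- `𝒪`-scalars act through `k`: `c • x = (c : k) • x`. [folklore] -/
theorem subring_smul_eq (c : 𝒪) (x : ⨂[k] i, V i) : c • x = (c : k) • x :=
  rfl

/-! ### Stability under integral maps -/

/-- **Stability.**  If `k`-linear maps `f_i : V_i → V_i` preserve the integral structures `N_i`,
then `⨂_i f_i` preserves the integral form. [folklore] -/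
theorem map_mem_piTensorIntForm (f : ∀ i, V i →ₗ[k] V i) (hf : ∀ i, ∀ v ∈ N i, f i v ∈ N i)
    {x : ⨂[k] i, V i} (hx : x ∈ piTensorIntForm 𝒪 N) :
    PiTensorProduct.map f x ∈ piTensorIntForm 𝒪 N := by
  induction hx using Submodule.span_induction with
  | mem x hx =>
    obtain ⟨m, hm, rfl⟩ := hx
    rw [PiTensorProduct.map_tprod]
    exact tprod_mem_piTensorIntForm fun i => hf i _ (hm i)
  | zero => rw [map_zero]; exact Submodule.zero_mem _
  | add x y _ _ hx hy => rw [map_add]; exact Submodule.add_mem _ hx hy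
  | smul c x _ hx =>
    rw [subring_smul_eq, map_smul, ← subring_smul_eq]
    exact Submodule.smul_mem _ c hx

/-! ### Congruences -/

/-- A pure tensor of integral vectors one of which lies in `I • N_{i₀}` lies in `I • ⨂ N`.
[folklore] -/
theorem tprod_mem_smul_piTensorIntForm [DecidableEq ι] (I : Ideal 𝒪) {m : ∀ i, V i}
    (hm : ∀ i, m i ∈ N i) (i₀ : ι) (h₀ : m i₀ ∈ I • N i₀) :
    tprod k m ∈ I • piTensorIntForm 𝒪 N := by
  rw [← Function.update_eq_self i₀ m]
  refine Submodule.smul_induction_on h₀ (fun r hr n hn => ?_) fun x y hx hy => ?_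
  · have : tprod k (Function.update m i₀ (r • n)) = r • tprod k (Function.update m i₀ n) := by
      rw [show (r • n : V i₀) = (r : k) • n from rfl, MultilinearMap.map_update_smul,
        subring_smul_eq]
    rw [this]
    refine Submodule.smul_mem_smul hr (tprod_mem_piTensorIntForm fun i => ?_)
    by_cases h : i = i₀
    · subst h
      rw [Function.update_self]
      exact hn
    · rw [Function.update_of_ne h]
      exact hm i
  · rw [MultilinearMap.map_update_add]
    exact Submodule.add_mem _ hx hy

/-- **Congruences.**  If `k`-linear maps `f_i` preserve the `N_i` and are congruent to the identity
modulo an ideal `I ⊆ 𝒪` on them (`f_i v - v ∈ I • N_i` for `v ∈ N_i`), then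
`(⨂_i f_i) x - x ∈ I • ⨂ N` for every integral `x`: expand `⊗_i (v_i + y_i)`, `y_i = f_i v_i - v_i`,
by multilinearity (`MultilinearMap.map_add_univ`); every term but `⊗_i v_i` has a factor
`y_i ∈ I • N_i`.  This is why a congruence subgroup of level `pᵐ` acts trivially on `M_ξ / pᵐ`.
[cite: Scholze2015, §V.4 (proof of Thm. V.4.1: "K_p is sufficiently small … trivial modulo pᵐ")] -/
theorem map_sub_mem_smul_piTensorIntForm [Fintype ι] (I : Ideal 𝒪) (f : ∀ i, V i →ₗ[k] V i)
    (hf : ∀ i, ∀ v ∈ N i, f i v ∈ N i) (hfI : ∀ i, ∀ v ∈ N i, f i v - v ∈ I • N i)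
    {x : ⨂[k] i, V i} (hx : x ∈ piTensorIntForm 𝒪 N) :
    PiTensorProduct.map f x - x ∈ I • piTensorIntForm 𝒪 N := by
  classical
  induction hx using Submodule.span_induction with
  | mem x hx =>
    obtain ⟨m, hm, rfl⟩ := hx
    rw [PiTensorProduct.map_tprod]
    -- `f m = m + y`
    set y : ∀ i, V i := fun i => f i (m i) - m i with hy
    have hfm : (fun i => f i (m i)) = m + y := by
      funext i
      simp [hy]
    rw [hfm, MultilinearMap.map_add_univ, ← Finset.sum_erase_add _ _ (Finset.mem_univ Finset.univ),
      Finset.piecewise_univ, add_sub_cancel_right]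
    refine Submodule.sum_mem _ fun s hs => ?_
    -- a coordinate `i₀ ∉ s` carries the factor `y i₀ ∈ I • N i₀`
    have hs' : s ≠ Finset.univ := Finset.ne_of_mem_erase hs
    obtain ⟨i₀, -, hi₀⟩ : ∃ i₀ ∈ Finset.univ, i₀ ∉ s := by
      by_contra h
      push Not at h
      exact hs' (Finset.eq_univ_of_forall fun i => h i (Finset.mem_univ i))
    refine tprod_mem_smul_piTensorIntForm I (fun i => ?_) i₀ ?_
    · by_cases h : i ∈ s
      · rw [Finset.piecewise_eq_of_mem _ _ _ h]
        exact hm i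
      · rw [Finset.piecewise_eq_of_notMem _ _ _ h]
        exact Submodule.sub_mem _ (hf i _ (hm i)) (hm i)
    · rw [Finset.piecewise_eq_of_notMem _ _ _ hi₀]
      exact hfI i₀ _ (hm i₀)
  | zero => rw [map_zero, sub_zero]; exact Submodule.zero_mem _
  | add x y _ _ hx hy =>
    rw [map_add, add_sub_add_comm]
    exact Submodule.add_mem _ hx hy
  | smul c x _ hx =>
    rw [subring_smul_eq, map_smul, ← smul_sub, ← subring_smul_eq]
    exact Submodule.smul_mem _ c hx

/-! ### The integral form is a `k`-form, and is finitely generated -/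

/-- **The integral form spans.**  If each `N_i` spans `V_i` over `k`, then `⨂ N` spans `⨂_i V_i`
over `k` (so that, over the fraction field of a domain `𝒪`, `(⨂ N)[1/ϖ] = ⨂_i V_i`).
[cite: Scholze2015, §V.4 ("M_ξ[p⁻¹] = M_{ξ,K} ⊗ ℚ̄_p")] -/
theorem span_piTensorIntForm_eq_top [Fintype ι]
    (hN : ∀ i, Submodule.span k (N i : Set (V i)) = ⊤) :
    Submodule.span k (piTensorIntForm 𝒪 N : Set (⨂[k] i, V i)) = ⊤ := by
  rw [piTensorIntForm, Submodule.span_span_of_tower, eq_top_iff, ← PiTensorProduct.span_tprod_eq_top,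
    Submodule.span_le]
  rintro _ ⟨m, rfl⟩
  refine tprod_mem_of_mem_span (R := k) (Submodule.span k (intTprods 𝒪 N)) (fun i => (N i : Set (V i)))
    (fun m hm => Submodule.subset_span ⟨m, hm, rfl⟩) m fun i => ?_
  rw [hN i]
  exact Submodule.mem_top

/-- **Finiteness.**  If each `N_i` is finitely generated over `𝒪`, so is `⨂ N` — generated by the
pure tensors of generators. [folklore] -/
theorem piTensorIntForm_fg [Fintype ι] (hN : ∀ i, (N i).FG) : (piTensorIntForm 𝒪 N).FG := by
  classical
  choose S hS using hN
  -- the finite set of pure tensors of generators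
  let T : Set (⨂[k] i, V i) := {x | ∃ m : ∀ i, V i, (∀ i, m i ∈ S i) ∧ tprod k m = x}
  have hTfin : T.Finite := by
    refine ((Fintype.piFinset S).finite_toSet.image fun m : ∀ i, V i => tprod k m).subset ?_
    rintro _ ⟨m, hm, rfl⟩
    exact ⟨m, by simpa [Fintype.mem_piFinset] using hm, rfl⟩
  refine ⟨hTfin.toFinset, le_antisymm ?_ ?_⟩
  · rw [Set.Finite.coe_toFinset, Submodule.span_le]
    rintro _ ⟨m, hm, rfl⟩
    exact tprod_mem_piTensorIntForm fun i => by
      rw [← hS i]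
      exact Submodule.subset_span (hm i)
  · rw [Set.Finite.coe_toFinset, piTensorIntForm, Submodule.span_le]
    rintro _ ⟨m, hm, rfl⟩
    refine tprod_mem_of_mem_span (R := 𝒪) (Submodule.span 𝒪 T) (fun i => (S i : Set (V i)))
      (fun m hm => Submodule.subset_span ⟨m, hm, rfl⟩) m fun i => ?_
    rw [hS i]
    exact hm i

/-- Monotonicity in the integral structures. [folklore] -/
theorem piTensorIntForm_mono {N' : ∀ i, Submodule 𝒪 (V i)} (h : ∀ i, N i ≤ N' i) :
    piTensorIntForm 𝒪 N ≤ piTensorIntForm 𝒪 N' :=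
  Submodule.span_mono fun _ ⟨m, hm, hx⟩ => ⟨m, fun i => h i (hm i), hx⟩

end Literature.LinearAlgebra.BaseChange
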